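import Literature.NumberTheory.Automorphic.RegularAlgebraicCuspidalHeckePointAssembly
import Literature.NumberTheory.Automorphic.TwistedQuotientRationalEigenclassLatticeFiniteType
import Literature.NumberTheory.Automorphic.BianchiGoodTranslateCover
import HarnessLib

/-!
# `bianchi_regularAlgebraicCuspidal_isHeckePoint` from the Eichler–Shimura–Harder existence
# statement alone

Topic `NumberTheory/Automorphic`; namespace `Literature.NumberTheory.Automorphic`.
Theorems only; no definition, no named fact, no instance, no `sorry`.

**`bianchi_regularAlgebraicCuspidal_isHeckePoint_of_eigenclassExists`** proves the named fact
`bianchi_regularAlgebraicCuspidal_isHeckePoint` (Scholze's Cor. V.4.2 in the form "the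
`p`-adically normalised Satake eigenvalues of a regular algebraic cuspidal `π` on `GL₂` over an
imaginary quadratic field form a `ℤ̄_p`-point of the big Hecke algebra `𝕋` of the `p`-power
principal congruence tower") from ONE input which is not yet a theorem of the tree:

* `hX : bianchi_cuspidal_regularLAlgebraic_eigenclassExists` — the Eichler–Shimura–Harder
  occurrence of `π` in the cohomology of the Bianchi manifolds [Harder1987], [Clozel1990, 3.14],
  a named fact of `BianchiCuspidalEigenclass`.

Compared with `…_of_eigenclassExists_of_typeFL` (`RegularAlgebraicCuspidalHeckePointAssembly`),
the Borel–Serre finiteness hypothesis `hFL` is GONE: the two finiteness properties of the integral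
cohomology of the stabilisers `Γ_x = GL₂(K) ∩ x U₀ x⁻¹` that the argument uses — finite
generation, and commutation with the directed union of scaled lattices (bounded denominators) —
are the theorem `BianchiCusp.isCohFiniteTypeUpTo_glIntegersRange` (Brown's criterion in
finite-type form, `GroupCohomologyGoodCoverFiniteType`, on the good translate cover of the cone of
binary Hermitian forms constructed in `BianchiCohomologyFinite`, packaged in
`BianchiGoodTranslateCover`), transported to the commensurable `Γ_x` up to a common multiplier
(`exists_uniform_cohFiniteType`; the multiplier is invertible in `ℚ̄_p` and is removed by the
`K`-scalability of the scaled lattices, `TwistedQuotientRationalEigenclassLatticeFiniteType`).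
The rest of the assembly ([Scholze2015, §V.4, proofs of Thm. V.4.1 and Cor. V.4.2]) is unchanged.

## References

* P. Scholze, *On torsion in the cohomology of locally symmetric varieties*, Ann. of Math. 182
  (2015), §V.4, Thm. V.4.1, Cor. V.4.2. [Scholze2015]
* A. Borel, J.-P. Serre, *Corners and arithmetic groups*, Comment. Math. Helv. 48 (1973), §11.
  [BorelSerre1973]
* K. S. Brown, *Cohomology of Groups*, GTM 87 (1982), VII (7.10), VIII (4.6), (5.1).
  [Brown1982CohomologyGroups]
* L. Clozel, *Motifs et formes automorphes* (1990), 3.14; G. Harder (1987). [Clozel1990]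
-/

noncomputable section

open CategoryTheory
open scoped NumberField
open IsDedekindDomain NumberField

namespace Literature.NumberTheory.Automorphic

open TwistedQuotient BigHeckeGLn PadicIntermediateField ResGLnCohomology ParallelWeight
  Literature.Algebra.Module Literature.Algebra.Homology

/-! ### A uniform multiplier for finitely many commensurable subgroups -/

section Uniform

/-- **Finitely many subgroups commensurable with one of finite type are of finite type up to a
common multiplier** (`IsCohFiniteTypeUpTo.of_commensurable` and the product of the indices).
[cite: Brown1982CohomologyGroups, VIII (5.1)] -/
theorem exists_uniform_cohFiniteType {G : Type} [Group G] {k : Type} [CommRing k]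
    (S : Subgroup G) (h₀ : IsCohFiniteTypeUpTo k S 1) {α : Type} (s : Finset α)
    (Γ : α → Subgroup G) (hc : ∀ x ∈ s, (Γ x).Commensurable S) :
    ∃ m : ℕ, m ≠ 0 ∧ ∀ x ∈ s, IsCohFiniteTypeUpTo k (Γ x) m := by
  classical
  induction s using Finset.induction_on with
  | empty => exact ⟨1, one_ne_zero, fun x hx => absurd hx (Finset.notMem_empty x)⟩
  | insert a s ha ih =>
    obtain ⟨m, hm, hms⟩ := ih fun x hx => hc x (Finset.mem_insert_of_mem hx)
    haveI : ((Γ a).subgroupOf S).FiniteIndex := ⟨(hc a (Finset.mem_insert_self a s)).1⟩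
    haveI hfi : (S.subgroupOf (Γ a)).FiniteIndex := ⟨(hc a (Finset.mem_insert_self a s)).2⟩
    have ha' : IsCohFiniteTypeUpTo k (Γ a) (1 * (S.subgroupOf (Γ a)).index) :=
      h₀.of_commensurable S (Γ a)
    refine ⟨m * (1 * (S.subgroupOf (Γ a)).index),
      mul_ne_zero hm (by rw [one_mul]; exact hfi.index_ne_zero), fun x hx => ?_⟩
    rcases Finset.mem_insert.1 hx with rfl | hx
    · exact ha'.of_dvd (dvd_mul_left _ _)
    · exact (hms x hx).mul_right _

end Uniform

/-! ### The assembly -/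

/-- **`bianchi_regularAlgebraicCuspidal_isHeckePoint` holds, given the Eichler–Shimura–Harder
eigenclass** (`bianchi_cuspidal_regularLAlgebraic_eigenclassExists`, the one remaining named fact):
the finiteness input of [Scholze2015, §V.4] — bounded denominators and finite generation of the
integral cohomology of the Bianchi congruence subgroups — is now the THEOREM
`BianchiCusp.isCohFiniteTypeUpTo_glIntegersRange` (Brown's criterion in finite-type form on the
good translate cover of the Hermitian cone, `BianchiGoodTranslateCover`), transported to the
stabilisers `Γ_x` by commensurability (`exists_uniform_cohFiniteType`) and fed to
`exists_intFun_exact_eigenclass_of_cohFiniteType`.  Otherwise the proof is that of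
`bianchi_regularAlgebraicCuspidal_isHeckePoint_of_eigenclassExists_of_typeFL` verbatim.
[cite: Scholze2015, §V.4, Cor. V.4.2 with the proof of Thm. V.4.1] [cite: BorelSerre1973, §11.1] -/
theorem bianchi_regularAlgebraicCuspidal_isHeckePoint_of_eigenclassExists
    (hX : bianchi_cuspidal_regularLAlgebraic_eigenclassExists) :
    bianchi_regularAlgebraicCuspidal_isHeckePoint := by
  intro K _ _ htc hdeg p _ ι hcpt π hπ S₀ hpS hunr
  classical
  have hp : p.Prime := Fact.out
  by_cases h0 : (0 : ℕ) ∈ S₀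
  · exact bianchi_regularAlgebraicCuspidal_isHeckePoint_of_zero_mem K p ι hcpt π S₀ h0
  obtain ⟨U, hUo', hUc', hU', hcl', hU1', -, wt, -, hρ⟩ :=
    bianchi_regularAlgebraicCuspidal_eigenclass_of_eigenclassExists hX K htc hdeg p ι hcpt π hπ S₀
      h0 hunr
  -- ### notation
  let good : HeightOneSpectrum (𝓞 K) → Prop := fun v => ∀ ℓ ∈ S₀, ((ℓ : ℕ) : 𝓞 K) ∉ v.asIdeal
  have hgood : ∀ v, good v → ((p : ℕ) : 𝓞 K) ∉ v.asIdeal := fun v hv => hv p hpS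
  -- ### the neat level `U₀ = U ∩ K_f(p²)`
  let 𝔫 : Ideal (𝓞 K) := Ideal.span {((p : ℕ) : 𝓞 K)} ^ 2
  have h𝔫 : 𝔫 ≠ 0 := pow_ne_zero 2 (by
    rw [Ne, Ideal.zero_eq_bot, Ideal.span_singleton_eq_bot]; exact_mod_cast hp.ne_zero)
  have hdvd𝔫 : ∀ v : HeightOneSpectrum (𝓞 K), v.asIdeal ∣ 𝔫 → ((p : ℕ) : 𝓞 K) ∈ v.asIdeal := by
    intro v hv
    have h := (Ideal.dvd_iff_le.1 hv) (Ideal.pow_mem_pow (Ideal.mem_span_singleton_self _) 2)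
    exact (v.isPrime.mem_or_mem (by simpa [pow_two] using h)).elim id id
  let U₀ : Subgroup (FiniteAdelicGL 2 K) :=
    U ⊓ (principalCongruenceLevel 2 K 𝔫).comap (GLn.ofFinite 2 K)
  have hle₀ : U₀ ≤ U := inf_le_left
  have hU₀o : IsOpen (U₀ : Set (FiniteAdelicGL 2 K)) := isOpen_inf_comap_principalCongruenceLevel hUo' h𝔫
  have hU₀c : IsCompact (U₀ : Set (FiniteAdelicGL 2 K)) :=
    isCompact_inf_comap_principalCongruenceLevel hUc' h𝔫
  have hU₀ : U₀ ≤ glFiniteIntegralLevel 2 K := hle₀.trans hU'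
  have hcl : ∀ g ∈ glFiniteIntegralLevel 2 K,
      (∀ v : HeightOneSpectrum (𝓞 K), ¬ (∀ ℓ ∈ S₀, ((ℓ : ℕ) : 𝓞 K) ∉ v.asIdeal) →
        ∀ i j : Fin 2, ((g : Matrix (Fin 2) (Fin 2) (FiniteAdeleRing (𝓞 K) K)) i j) v =
          (1 : Matrix (Fin 2) (Fin 2) (v.adicCompletion K)) i j) → g ∈ U₀ := by
    intro g hg hgS
    refine ⟨hcl' g hg hgS, mem_comap_principalCongruenceLevel_of_localComponent h𝔫 hg fun v hv => ?_⟩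
    have hv' : ¬ ∀ ℓ ∈ S₀, ((ℓ : ℕ) : 𝓞 K) ∉ v.asIdeal := fun h => h p hpS (hdvd𝔫 v hv)
    exact Matrix.GeneralLinearGroup.ext fun i j => by
      rw [coe_localComponent_apply, hgS v hv' i j, Units.val_one]
  have hU1 : ∀ v : HeightOneSpectrum (𝓞 K), good v →
      ∀ g ∈ valuedCongruenceSubgroup (Fin 2) (1 : WithZero (Multiplicative ℤ)), ofLocal 2 K v g ∈ U₀ :=
    fun v hv g hg => ⟨hU1' v hv g hg,
      (isUnramifiedLevel_comap_principalCongruenceLevel h𝔫 (fun h => hgood v hv (hdvd𝔫 v h))).map_mem hg⟩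
  -- unramifiedness of `U` and `U₀` at the good places (Hecke compatibility of the pull-back)
  have hunrU : ∀ v, good v → ArithmeticQuotient.IsUnramifiedLevel
      (valuedCongruenceSubgroup (Fin 2) (1 : WithZero (Multiplicative ℤ))) (ofLocal 2 K v)
      (localComponent 2 K v) U := fun v hv =>
    isUnramifiedLevel_of_le (by rintro _ ⟨g, hg, rfl⟩; exact hU1' v hv g hg)
      fun u hu => localComponent_mem_valuedCongruenceSubgroup_one (hU' hu) v
  have hunrU₀ : ∀ v, good v → ArithmeticQuotient.IsUnramifiedLevel
      (valuedCongruenceSubgroup (Fin 2) (1 : WithZero (Multiplicative ℤ))) (ofLocal 2 K v)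
      (localComponent 2 K v) U₀ := fun v hv =>
    isUnramifiedLevel_of_le (by rintro _ ⟨g, hg, rfl⟩; exact hU1 v hv g hg)
      fun u hu => localComponent_mem_valuedCongruenceSubgroup_one (hU₀ hu) v
  haveI hfiU : (U₀.subgroupOf U).FiniteIndex := Subgroup.finiteIndex_subgroupOf_of_isCompact_isOpen hUc' hU₀o
  refine ⟨U₀, hU₀o, hU₀, hcl, fun ϖ hϖ => ?_⟩
  let gE := globalEmbedding 2 K
  let V := CoeffModule (PadicAlgCl p) 2 K wt
  let πV : Representation (PadicAlgCl p) (FiniteAdelicGL 2 K) V := padicCoeffRep 2 K p wt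
  let ρp : Representation (PadicAlgCl p) (GL (Fin 2) K) V := πV.comp gE
  -- the Satake parameters at the good places and the prospective values `b`
  have hsat : ∀ v, good v → ∃ α : Multiset ℂ, π.1.HasSatakeParamAt v α := fun v hv => hunr v hv
  let αv : HeightOneSpectrum (𝓞 K) → Multiset ℂ := fun v =>
    if h : good v then (hsat v h).choose else 0
  have hαv : ∀ v, good v → π.1.HasSatakeParamAt v (αv v) := fun v hv => by
    simp only [αv, dif_pos hv]; exact (hsat v hv).choose_spec
  let bval : HeightOneSpectrum (𝓞 K) → ℕ → PadicAlgCl p := fun v i =>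
    if i = 1 then ι.symm ((((Real.sqrt (v.residueCard : ℝ)) : ℝ) : ℂ) * (αv v).esymm 1)
    else ι.symm ((αv v).esymm 2)
  -- ### the eigenclass over `ℚ̄_p`, in the `p`-adic coefficient representation, at level `U`
  obtain ⟨q, ξ, hξ, heigξ⟩ := hρ _ rfl
  let Φ := ResGLnCohomology.cohomologyIsoPadic 2 K p wt U (ρ := _) rfl q
  let ξU : TwistedQuotient.cohomology gE U ρp q := Φ.inv.hom ξ
  have hξU : ξU ≠ 0 := cohomologyIsoPadic_inv_apply_ne_zero 2 K p wt U rfl q hξ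
  let J := {v // good v} × Fin 2
  let δ : J → FiniteAdelicGL 2 K := fun j => GLn.sndHom 2 K (heckeDiagAt 2 K j.1.1 (ϖ j.1.1) (j.2.val + 1))
  let χ : J → PadicAlgCl p := fun j => bval j.1.1 (j.2.val + 1)
  have heigU : ∀ j : J, TwistedQuotient.heckeEnd gE U ρp (δ j) q ξU = χ j • ξU := by
    rintro ⟨⟨v, hv⟩, i⟩
    obtain ⟨h1, h2⟩ := heigξ ϖ hϖ v hv (αv v) (hαv v hv)
    fin_cases i
    · change TwistedQuotient.heckeEnd gE U ρp (GLn.sndHom 2 K (heckeDiagAt 2 K v (ϖ v) 1)) q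
        (Φ.inv.hom ξ) = bval v 1 • Φ.inv.hom ξ
      rw [← cohomologyIsoPadic_inv_heckeEnd, h1, map_smul]
      rfl
    · change TwistedQuotient.heckeEnd gE U ρp (GLn.sndHom 2 K (heckeDiagAt 2 K v (ϖ v) 2)) q
        (Φ.inv.hom ξ) = bval v 2 • Φ.inv.hom ξ
      rw [← cohomologyIsoPadic_inv_heckeEnd, h2, map_smul]
      rfl
  -- no `ℕ`-torsion in the `ℚ̄_p`-cohomology
  have hWn : ∀ (L' : Subgroup (FiniteAdelicGL 2 K)) (m : ℕ), m ≠ 0 →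
      ∀ w : TwistedQuotient.cohomology gE L' ρp q, m • w = 0 → w = 0 := fun L' m hm w h => by
    rw [← Nat.cast_smul_eq_nsmul (PadicAlgCl p)] at h
    exact (smul_eq_zero.1 h).resolve_left (Nat.cast_ne_zero.2 hm)
  have hWp : ∀ (m : ℕ) (w : TwistedQuotient.cohomology gE U₀ ρp q), w ≠ 0 →
      ((p : ℕ) : PadicAlgCl p) ^ m • w ≠ 0 := fun m w hw h => hw (by
    have hp0 : ((p : ℕ) : PadicAlgCl p) ^ m ≠ 0 := pow_ne_zero m (Nat.cast_ne_zero.2 hp.ne_zero)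
    exact (smul_eq_zero.1 h).resolve_left hp0)
  -- ### pull back to the neat level `U₀` (injective, Hecke-equivariant at the good places)
  let ξ' : TwistedQuotient.cohomology gE U₀ ρp q := (pullbackMap gE ρp hle₀ q).hom ξU
  have hξ' : ξ' ≠ 0 := fun h =>
    hξU (pullbackMap_injective gE ρp hle₀ q (hWn U _ hfiU.index_ne_zero) (by rw [map_zero]; exact h))
  have heig' : ∀ j : J, TwistedQuotient.heckeEnd gE U₀ ρp (δ j) q ξ' = χ j • ξ' := by
    rintro ⟨⟨v, hv⟩, i⟩
    have hδ : δ (⟨v, hv⟩, i) = ofLocal 2 K v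
        (glDiagonal 2 (v.adicCompletion K) fun l => if (l : ℕ) < i.val + 1 then ϖ v else 1) :=
      sndHom_heckeDiagAt_eq_ofLocal v (ϖ v) (i.val + 1)
    have h := heigU (⟨v, hv⟩, i)
    rw [hδ] at h ⊢
    change TwistedQuotient.heckeEnd gE U₀ ρp _ q ((pullbackMap gE ρp hle₀ q).hom ξU) =
      χ (⟨v, hv⟩, i) • (pullbackMap gE ρp hle₀ q).hom ξU
    rw [← pullbackMap_heckeEnd_of_isUnramifiedLevel gE ρp hle₀ (hunrU v hv) (hunrU₀ v hv) _
      (finite_doubleCosetQuot_of_isCompact_isOpen U hUc' hUo' _) q ξU, h, map_smul]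
  -- ### orbit representatives for `(GL₂(K), U₀)`
  obtain ⟨sq, hsq⟩ := exists_finset_orbit_cover K U₀ hU₀o
  obtain ⟨sO, -, hdisj, hcov⟩ := exists_orbit_representatives_ind gE U₀ (sq.image Quotient.out)
    (fun g => by
      obtain ⟨x, hx, γ, hγ⟩ := hsq (g : FiniteAdelicGL 2 K ⧸ U₀)
      refine ⟨x.out, Finset.mem_image_of_mem _ hx, γ, ?_⟩
      rw [QuotientGroup.out_eq']
      exact hγ)
  -- ### the stabilisers are of finite type, uniformly on the orbit representatives
  have hFTorb : ∀ (k : Type) [CommRing k], ∃ m : ℕ, m ≠ 0 ∧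
      ∀ x ∈ sO, IsCohFiniteTypeUpTo k (orbitStabilizer gE U₀ (x : FiniteAdelicGL 2 K ⧸ U₀)) m := by
    intro k _
    haveI := htc
    exact exists_uniform_cohFiniteType _ (BianchiCusp.isCohFiniteTypeUpTo_glIntegersRange hdeg k) sO
      (fun x => orbitStabilizer gE U₀ (x : FiniteAdelicGL 2 K ⧸ U₀))
      (fun x _ => commensurable_orbitStabilizer_glIntegers U₀ hU₀o hU₀c _)
  have hminv : ∀ m : ℕ, m ≠ 0 → ∃ c : PadicAlgCl p, c * m = 1 := fun m hm =>
    ⟨((m : ℕ) : PadicAlgCl p)⁻¹, inv_mul_cancel₀ (Nat.cast_ne_zero.2 hm)⟩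
  -- ### Stage 1: the eigenvalues lie in a finite `E₁ ⊇ coeffField` and are integral
  obtain ⟨E₁, hE₁fin, hE₁, hχE₁, hχint⟩ : ∃ (E₁ : IntermediateField ℚ_[p] (PadicAlgCl p)),
      FiniteDimensional ℚ_[p] E₁ ∧ coeffField K p ≤ E₁ ∧ (∀ j, χ j ∈ E₁) ∧
      ∀ j, IsIntegral ℤ_[p] (χ j) := by
    -- work over `k₀ = 𝒪_{E₀}`, `E₀ = coeffField`
    let E₀ := coeffField K p
    haveI : FiniteDimensional ℚ_[p] E₀ := finiteDimensional_coeffField K p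
    let k₀ := unitBall p E₀
    haveI : IsNoetherianRing k₀ := isNoetherianRing_unitBall p E₀
    let M₀ : Submodule k₀ V := coeffIntForm (PadicAlgCl p) k₀ 2 K wt
    have hM₀ : ∀ u ∈ U₀, ∀ m ∈ M₀, resScalars k₀ πV u m ∈ M₀ := fun u hu m hm =>
      padicCoeffRep_mem_coeffIntForm_unitBall p E₀ le_rfl wt (hU₀ hu) hm
    -- the comparison of the `k₀`- and the `ℚ̄_p`-cohomology, at the types of the lattice files
    let rS : groupCohomology (coeffRep gE U₀ ((resScalars k₀ πV).comp gE)) q →ₛₗ[algebraMap k₀ (PadicAlgCl p)]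
        TwistedQuotient.cohomology gE U₀ ρp q := cohomologyResScalars k₀ gE U₀ ρp q
    have hrSsurj : Function.Surjective rS := (cohomologyResScalars_bijective k₀ gE U₀ ρp q).2
    have hrST : ∀ (g : FiniteAdelicGL 2 K) (x : groupCohomology (coeffRep gE U₀ ((resScalars k₀ πV).comp gE)) q),
        rS (TwistedQuotient.heckeEnd gE U₀ ((resScalars k₀ πV).comp gE) g q x) =
          TwistedQuotient.heckeEnd gE U₀ ρp g q (rS x) := fun g x =>
      cohomologyResScalars_heckeEnd k₀ gE U₀ ρp g q x
    -- the class over `k₀` and a lattice cohomology class above it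
    obtain ⟨y₀, hy₀⟩ := hrSsurj ξ'
    obtain ⟨mO, hmO, hFT₀⟩ := hFTorb k₀
    obtain ⟨s, y, hy⟩ := exists_intFun_map_eq_of_cohFiniteType gE U₀ πV M₀ hM₀ sO hdisj hcov
      (span_coeffIntForm_eq_top (PadicAlgCl p) k₀ 2 K wt) hFT₀ (hminv mO hmO) q y₀
    -- the finitely generated image `L` of `H^q(intFun M_s)` in the `ℚ̄_p`-cohomology
    let Hs := groupCohomology (intFun gE U₀ (resScalars k₀ πV) (scaledLattice M₀ s)) q
    let fI := cohMapQ (intFunι gE U₀ (resScalars k₀ πV) (scaledLattice M₀ s)) q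
    let fS : Hs →ₗ[k₀] TwistedQuotient.cohomology gE U₀ ρp q :=
      { toFun := fun z => rS (fI z)
        map_add' := fun z z' => by simp only [map_add]
        map_smul' := fun c z => by rw [map_smul, map_smulₛₗ, RingHom.id_apply, algebraMap_smul] }
    haveI : Module.Finite k₀ Hs := moduleFinite_cohomology_intFun_scaledLattice_of_cohFiniteType gE U₀ πV
      M₀ hM₀ sO hdisj hcov (coeffIntForm_fg (PadicAlgCl p) k₀ 2 K wt) hFT₀ q s
    let L : Submodule k₀ (TwistedQuotient.cohomology gE U₀ ρp q) := LinearMap.range fS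
    have hLfg : L.FG := Module.Finite.iff_fg.1 inferInstance
    have hξ'L : ξ' ∈ L := ⟨y, by change rS (fI y) = ξ'; rw [hy]; exact hy₀⟩
    have hLT : ∀ j : J, ∀ w ∈ L, TwistedQuotient.heckeEnd gE U₀ ρp (δ j) q w ∈ L := by
      rintro j _ ⟨z, rfl⟩
      refine ⟨cohMapQ (heckeIntHom gE U₀ (resScalars k₀ πV) (scaledLattice M₀ s)
        (scaledLattice_stable M₀ πV U₀ hM₀ s) (g₀ := δ j) (rep_mem_of_eq_one _ _
          (resScalars_unitBall_padicCoeffRep_sndHom_heckeDiagAt p E₀ wt (hgood _ j.1.2) (ϖ j.1.1)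
            (j.2.val + 1)))) q z, ?_⟩
      change rS (fI (cohMapQ _ q z)) = TwistedQuotient.heckeEnd gE U₀ ρp (δ j) q (rS (fI z))
      rw [← hrST]
      congr 1
      change cohMapQ _ q (cohMapQ _ q z) = cohMapQ _ q (cohMapQ _ q z)
      rw [← cohMapQ_comp, heckeIntHom_comp_intFunι, cohMapQ_comp]
    -- the finitely generated module of scalars moving `ξ'` into `L` contains all the eigenvalues
    let Sc : Submodule k₀ (PadicAlgCl p) := scalingSubmodule (PadicAlgCl p) L ξ'
    have hχSc : ∀ j, χ j ∈ Sc := fun j =>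
      eigenvalue_mem_scalingSubmodule L ξ' (TwistedQuotient.heckeEnd gE U₀ ρp (δ j) q) (hLT j) hξ'L
        (χ j) (heig' j)
    obtain ⟨G, hG⟩ := scalingSubmodule_fg (PadicAlgCl p) L ξ' hLfg hξ'
    let E : IntermediateField ℚ_[p] (PadicAlgCl p) := E₀ ⊔ IntermediateField.adjoin ℚ_[p] (G : Set (PadicAlgCl p))
    haveI : FiniteDimensional ℚ_[p] (IntermediateField.adjoin ℚ_[p] (G : Set (PadicAlgCl p))) :=
      IntermediateField.finiteDimensional_adjoin fun x _ =>
        (Algebra.IsAlgebraic.isAlgebraic (R := ℚ_[p]) x).isIntegral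
    -- `E` as a `k₀`-submodule of `ℚ̄_p` (`k₀ ⊆ E₀ ⊆ E`)
    let Ek : Submodule k₀ (PadicAlgCl p) :=
      { carrier := (E : Set (PadicAlgCl p))
        zero_mem' := E.zero_mem
        add_mem' := fun ha hb => E.add_mem ha hb
        smul_mem' := fun c x hx => by
          rw [Subring.smul_def, smul_eq_mul]
          exact E.mul_mem ((le_sup_left : E₀ ≤ E) (mem_of_mem_unitBall p E₀ c.2)) hx }
    have hScE : Sc ≤ Ek := by
      show scalingSubmodule (PadicAlgCl p) L ξ' ≤ Ek
      rw [← hG, Submodule.span_le]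
      intro g hg
      exact (le_sup_right : IntermediateField.adjoin ℚ_[p] (G : Set (PadicAlgCl p)) ≤ E)
        (IntermediateField.subset_adjoin ℚ_[p] _ hg)
    refine ⟨E, IntermediateField.finiteDimensional_sup E₀ _, le_sup_left, fun j => hScE (hχSc j),
      fun j => ?_⟩
    have hint : IsIntegral k₀ (χ j) :=
      isIntegral_eigenvalue L ξ' hLfg hξ'L hξ' (TwistedQuotient.heckeEnd gE U₀ ρp (δ j) q) (hLT j)
        (χ j) (heig' j)
    haveI : Algebra.IsIntegral ℤ_[p] k₀ := Algebra.IsIntegral.of_finite ℤ_[p] k₀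
    exact isIntegral_trans (χ j) hint
  -- ### Stage 2: over `k₁ = 𝒪_{E₁}`
  haveI := hE₁fin
  let k₁ := unitBall p E₁
  have hχ₁ : ∀ j, χ j ∈ k₁ := fun j => mem_unitBall_of_isIntegral p E₁ (hχE₁ j) (hχint j)
  let χ₁ : J → k₁ := fun j => ⟨χ j, hχ₁ j⟩
  let M₁ : Submodule k₁ V := coeffIntForm (PadicAlgCl p) k₁ 2 K wt
  have hM₁ : ∀ u ∈ U₀, ∀ m ∈ M₁, resScalars k₁ πV u m ∈ M₁ := fun u hu m hm =>
    padicCoeffRep_mem_coeffIntForm_unitBall p E₁ hE₁ wt (hU₀ hu) hm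
  let rS₁ : groupCohomology (coeffRep gE U₀ ((resScalars k₁ πV).comp gE)) q →ₛₗ[algebraMap k₁ (PadicAlgCl p)]
      TwistedQuotient.cohomology gE U₀ ρp q := cohomologyResScalars k₁ gE U₀ ρp q
  have hrS₁bij : Function.Bijective rS₁ := cohomologyResScalars_bijective k₁ gE U₀ ρp q
  have hrS₁T : ∀ (g : FiniteAdelicGL 2 K) (x : groupCohomology (coeffRep gE U₀ ((resScalars k₁ πV).comp gE)) q),
      rS₁ (TwistedQuotient.heckeEnd gE U₀ ((resScalars k₁ πV).comp gE) g q x) =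
        TwistedQuotient.heckeEnd gE U₀ ρp g q (rS₁ x) := fun g x =>
    cohomologyResScalars_heckeEnd k₁ gE U₀ ρp g q x
  obtain ⟨ξ₁, hξ₁⟩ := hrS₁bij.2 ξ'
  have hξ₁p : ∀ m : ℕ, (p : k₁) ^ m • ξ₁ ≠ 0 := by
    intro m hm
    have h := congrArg rS₁ hm
    rw [map_smulₛₗ, map_zero, map_pow, map_natCast, hξ₁] at h
    exact hWp m ξ' hξ' h
  have heig₁ : ∀ j, TwistedQuotient.heckeEnd gE U₀ ((resScalars k₁ πV).comp gE) (δ j) q ξ₁ = χ₁ j • ξ₁ := by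
    intro j
    apply hrS₁bij.1
    rw [hrS₁T, map_smulₛₗ, hξ₁, heig' j]
    rfl
  have hδ₁ : ∀ j : J, resScalars k₁ πV (δ j) = 1 := fun j =>
    resScalars_unitBall_padicCoeffRep_sndHom_heckeDiagAt p E₁ wt (hgood _ j.1.2) (ϖ j.1.1) _
  haveI : Module.IsTorsionFree k₁ V := by
    rw [Module.isTorsionFree_iff_smul_eq_zero]
    intro c v hcv
    rcases eq_or_ne c 0 with rfl | hc
    · exact Or.inl rfl
    · right
      rw [Subring.smul_def] at hcv
      exact (smul_eq_zero.1 hcv).resolve_left (fun h => hc (Subtype.ext h))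
  -- the congruences `K_f((p)^r)` on `M₁`
  let Lev : ℕ → Subgroup (FiniteAdelicGL 2 K) := fun r =>
    U₀ ⊓ (principalCongruenceLevel 2 K (Ideal.span {((p : ℕ) : 𝓞 K)} ^ r)).comap (GLn.ofFinite 2 K)
  have hcong : ∀ t' : ℕ, ∃ r : ℕ, ∀ l ∈ U₀, l ∈ Lev r → ∀ m ∈ M₁,
      πV l m - m ∈ (Ideal.span {((p ^ t' : ℕ) : k₁)} : Ideal k₁) • M₁ := by
    intro t'
    refine ⟨t', fun l hl hl' m hm => ?_⟩
    rw [Nat.cast_pow]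
    exact padicCoeffRep_sub_mem_smul_coeffIntForm_unitBall p E₁ hE₁ wt t' (hU₀ hl) hl'.2 hm
  obtain ⟨m1, hm1, hFT₁⟩ := hFTorb k₁
  obtain ⟨M', hM', d, e, c, m₀, -, hmod, heigc, -, hcont⟩ :=
    exists_intFun_exact_eigenclass_of_cohFiniteType gE U₀ πV M₁ hM₁ sO hdisj hcov
      (coeffIntForm_fg (PadicAlgCl p) k₁ 2 K wt)
      (span_coeffIntForm_eq_top (PadicAlgCl p) k₁ 2 K wt) (natCast_prime_mem_maximalIdeal p E₁)
      hFT₁ (hminv m1 hm1) δ hδ₁ χ₁ Lev hcong ξ₁ hξ₁p heig₁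
  -- ### the `ℤ̄_p`-point
  have hpoint := isHeckePoint_principalPowerTower_of_intFun_eigenclass_unitBall p E₁ wt good hgood
    hU₀o hU₀c hU₀ hU1 M' hM' e hmod ϖ (fun v i => if i = 1 then χ₁ (v, 0) else χ₁ (v, 1)) c
    (fun j => by
      rcases j with ⟨v, i⟩
      fin_cases i
      · exact heigc (v, 0)
      · exact heigc (v, 1)) hcont
  refine ⟨fun v i => algebraMap k₁ _ (if i = 1 then χ₁ (v, 0) else χ₁ (v, 1)), fun v hv α hα => ?_, ?_⟩
  · -- the values: `ι(b_{v,1}) = q_v^{1/2} e₁(α)`, `ι(b_{v,2}) = e₂(α)` (Satake uniqueness)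
    have hαeq : α = αv v := AutomorphicRepData.hasSatakeParamAt_unique_holds π.1 hα (hαv v hv)
    subst hαeq
    constructor
    · change ι ((χ₁ (⟨v, hv⟩, 0) : k₁) : PadicAlgCl p) = _
      simp [χ₁, χ, bval]
    · change ι ((χ₁ (⟨v, hv⟩, 1) : k₁) : PadicAlgCl p) = _
      simp [χ₁, χ, bval]
  · exact hpoint

end Literature.NumberTheory.Automorphic
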